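import Summits.ResolutionOfSingularities.ResolutionOfSingularities.Theorems.WeightedInvariantKRedWeightedDropHomBaseChange
import Literature.AlgebraicGeometry.Resolution.AdicCompletionRegular
import HarnessLib

/-!
# (K-red-2): the TYPED COMPLETE-CASE TARGET `KWildHomCompleteOf` and the reduction `KWildHomOf ⟸ KWildHomCompleteOf`

Route `ResolutionOfSingularities/WeightedInvariant`, door crux `HypersurfaceCentreConstruction` (stmt-ResolutionOfSingularities-19897), P3 rung; ORDER (o60)
of res-L1-w43-plan-1 to res-type-060 («(K) general is a statement in the power-series ring»), second deliverable.  [OURS · L1 W4.3 · helper, counted 0]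
AI proof, weaker than expert review; bookkeeping on OUR clause vocabulary (`Iota3.KWildHomOf`, p540275); nothing here is a statement of the manuscript.

* `Iota3.KWildHomCompleteOf Pos ι p` — `KWildHomOf` with the binder `Algebra.EssFiniteType k₀ S` REPLACED by `IsAdicComplete (maximalIdeal S) S`: the (drop)
  conjunct at `t`-homogeneous successors for COMPLETE regular local `k₀`-algebras of dimension `≤ 3` (by Cohen, `Literature…exists_ringEquiv_mvPowerSeries_residueField`,
  these are the `K⟦u₁, …, u_d⟧`, where the K1 certificate p542872 and the idea-1/idea-2 census live).  THIS is the statement the (K) hand proves.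
* the transfer schemas `Iota3.PosCompletes Pos p` (the position class passes to the completion on the door's rings), `Iota3.IotaCompletes ι p` and
  `Iota3.IotaCobordantCompletes ι p` (the two `ι`-equalities of p553220's `KRed.weightedDropHom_of_baseChange`, on the door's rings) — the dense-class rows
  of (c11) for the owners of `Pos`/`ι` (for `ι = iotaOrd`, `Iota3.iotaSigma` and every `IotaDenseCompatible ι` they are PROVED here).
* **`Iota3.kWildHomOf_of_complete : KWildHomCompleteOf Pos ι p → PosCompletes Pos p → IotaCompletes ι p → IotaCobordantCompletes ι p → KWildHomOf Pos ι p`**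
  and `kWildHomOf_of_complete_of_iotaDenseCompatible`.  Everything about the completion `Ŝ = AdicCompletion 𝔪 S` is PROVED: `f·1 ≠ 0` (Krull), `f·1 ∈ 𝔪̂²`,
  `dim Ŝ = dim S`, `Ŝ` regular and complete (Literature `AdicCompletionRegular`), the r.s.p. and `spanFinrank 𝔪̂ = 3` (Mathlib), `ν` (res-type-057) and
  `IsSigmaMaximiser` (p547970) transfer, and the (drop) conjunct descends by (K-red) (p551914/p553220).
-/

noncomputable section

set_option linter.dupNamespace false -- mandated namespace of this single-conjunct summit

open IsLocalRing Literature.AlgebraicGeometry.Resolution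
open Summit.ResolutionOfSingularities.ResolutionOfSingularities.Theorems
open scoped LaurentPolynomial

namespace Summit.ResolutionOfSingularities.ResolutionOfSingularities.Cruxes.HypersurfaceCentreConstruction.LocalEngine

namespace Iota3

/-- [OURS · (o60) · candidate · conjecture-grade] **(K-wild-hom), COMPLETE CASE**: `KWildHomOf Pos ι p` with the essential-finite-type binder replaced by
COMPLETENESS — at every complete regular local `k₀`-algebra `S` (`k₀` perfect of characteristic `p`, `dim S ≤ 3`), every `0 ≠ f ∈ 𝔪²` with `Pos S f`,
every σ-attaining two-flag `(g₁, g₂; q, r₁, r₂)` completed by `x`, the (drop) conjunct holds at the `t`-homogeneous successor primes.  The target the (K)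
hand proves (in `K⟦u₁, …, u_d⟧` by Cohen); a predicate of the line, not a cited statement. -/
def KWildHomCompleteOf (Pos : (R : Type) → [CommRing R] → [IsLocalRing R] → R → Prop) (ι : (R : Type) → [CommRing R] → R → Ordinal.{0})
    (p : ℕ) : Prop :=
  ∀ (k₀ : Type) [Field k₀] [CharP k₀ p] [PerfectField k₀]
    (S : Type) [CommRing S] [Algebra k₀ S] [IsRegularLocalRing S] [IsAdicComplete (maximalIdeal S) S] (f : S),
    ringKrullDim S ≤ 3 → f ≠ 0 → f ∈ (maximalIdeal S) ^ 2 →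
    Pos S f →
    ∀ (ν : ℕ), iotaOrd S f = ν →
    ∀ (x g₁ g₂ : S) (q r₁ r₂ : ℕ),
      Ideal.span {x, g₂, g₁} = maximalIdeal S → (maximalIdeal S).spanFinrank = 3 →
      IsSigmaMaximiser f ν g₁ g₂ q r₁ r₂ → IsPrimitiveTriple q r₁ r₂ →
      WeightedDropHom ι S f (maximalIdeal S) ![x, g₂, g₁] ![q, r₂, r₁]

/-- [OURS · (o60)] **The position class passes to the completion** on the door's rings: for `S` regular local, essentially of finite type over a perfect
field of characteristic `p`, `dim S ≤ 3`, `0 ≠ f ∈ 𝔪²`: `Pos S f → Pos Ŝ (f·1)`.  (For `IsIsolatedPosition` / `IsTiePosition` this is the excellence of `S`: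
orders along the primes of `Ŝ` are read on their traces in `S`, Literature `CompletionPrimeOrderGenerization`.)  A transfer schema, not a cited statement. -/
def PosCompletes (Pos : (R : Type) → [CommRing R] → [IsLocalRing R] → R → Prop) (p : ℕ) : Prop :=
  ∀ (k₀ : Type) [Field k₀] [CharP k₀ p] [PerfectField k₀]
    (S : Type) [CommRing S] [Algebra k₀ S] [Algebra.EssFiniteType k₀ S] [IsRegularLocalRing S] (f : S),
    ringKrullDim S ≤ 3 → f ≠ 0 → f ∈ (maximalIdeal S) ^ 2 → Pos S f →
    Pos (AdicCompletion (maximalIdeal S) S) (algebraMap S (AdicCompletion (maximalIdeal S) S) f)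

/-- [OURS · (o60)] **`ι` passes to the completion** on the door's rings: `ι Ŝ (f·1) = ι S f`.  A transfer schema (the `S → Ŝ` row of (c11)); proved below
for every `IotaDenseCompatible ι`, in particular `ν` and `σ`. -/
def IotaCompletes (ι : (R : Type) → [CommRing R] → R → Ordinal.{0}) (p : ℕ) : Prop :=
  ∀ (k₀ : Type) [Field k₀] [CharP k₀ p] [PerfectField k₀]
    (S : Type) [CommRing S] [Algebra k₀ S] [Algebra.EssFiniteType k₀ S] [IsRegularLocalRing S] (f : S),
    ι (AdicCompletion (maximalIdeal S) S) (algebraMap S (AdicCompletion (maximalIdeal S) S) f) = ι S f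

/-- [OURS · (o60)] **`ι` passes along the base change `B_𝔫 → B̂_𝔫̂` of the cobordant algebra to the completion**, at the `t`-homogeneous primes
`𝔫 ∋ t⁻¹` over `𝔪` off the vertex (`𝔫̂ = 𝔫·B̂`), on the door's rings: the hypothesis `hιB` of `KRed.weightedDropHom_of_baseChange`.  A transfer schema
(the `B_𝔫 → B̂_𝔫̂` row of (c11)); proved below for every `IotaDenseCompatible ι`. -/
def IotaCobordantCompletes (ι : (R : Type) → [CommRing R] → R → Ordinal.{0}) (p : ℕ) : Prop :=
  ∀ (k₀ : Type) [Field k₀] [CharP k₀ p] [PerfectField k₀]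
    (S : Type) [CommRing S] [Algebra k₀ S] [Algebra.EssFiniteType k₀ S] [IsRegularLocalRing S]
    {n : ℕ} (u : Fin n → S) (w : Fin n → ℕ)
    (ψ : cobordantAlgebra' u w →+* cobordantAlgebra' (fun i => algebraMap S (AdicCompletion (maximalIdeal S) S) (u i)) w),
    (∀ x : cobordantAlgebra' u w,
      ((ψ x : cobordantAlgebra' (fun i => algebraMap S (AdicCompletion (maximalIdeal S) S) (u i)) w) : (AdicCompletion (maximalIdeal S) S)[T;T⁻¹]) =
        AddMonoidAlgebra.mapRingHom ℤ (algebraMap S (AdicCompletion (maximalIdeal S) S)) (x : S[T;T⁻¹])) →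
    ∀ (𝔫 : Ideal (cobordantAlgebra' u w)) [𝔫.IsPrime] [(𝔫.map ψ).IsPrime],
      IsTHomogeneous u w 𝔫 → cobordantT' u w ∈ 𝔫 → (maximalIdeal S).map (algebraMap S (cobordantAlgebra' u w)) ≤ 𝔫 →
      ¬ extReesAlgebra.vertexIdeal (weightedMonomialIdeal u w) ≤ 𝔫 →
      ∀ g : cobordantAlgebra' u w,
        ι (Localization.AtPrime (𝔫.map ψ)) (algebraMap _ (Localization.AtPrime (𝔫.map ψ)) (ψ g)) =
          ι (Localization.AtPrime 𝔫) (algebraMap _ (Localization.AtPrime 𝔫) g)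

/-! ## The schemas hold for every `IotaDenseCompatible ι` (in particular `ν`, `σ`) -/

/-- `IotaDenseCompatible ι → IotaCompletes ι p`. [OURS · L1 W4.3] -/
theorem iotaCompletes_of_iotaDenseCompatible {ι : (R : Type) → [CommRing R] → R → Ordinal.{0}} (hι : IotaDenseCompatible ι) (p : ℕ) :
    IotaCompletes ι p := by
  intro k₀ _ _ _ S _ _ _ _ f
  haveI := isNoetherianRing_adicCompletion_maximalIdeal S
  exact hι S _ (map_maximalIdeal_adicCompletion S) (adicCompletion_dense S) f

/-- `IotaDenseCompatible ι → IotaCobordantCompletes ι p` (p553220 `KRed.iotaB_of_iotaDenseCompatible`). [OURS · L1 W4.3] -/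
theorem iotaCobordantCompletes_of_iotaDenseCompatible {ι : (R : Type) → [CommRing R] → R → Ordinal.{0}} (hι : IotaDenseCompatible ι) (p : ℕ) :
    IotaCobordantCompletes ι p := by
  intro k₀ _ _ _ S _ _ _ _ n u w ψ hψ 𝔫 _ _ _ _ h𝔪 _ g
  haveI := isNoetherianRing_adicCompletion_maximalIdeal S
  exact KRed.iotaB_of_iotaDenseCompatible u w ψ hψ (map_maximalIdeal_adicCompletion S) (adicCompletion_dense S) hι 𝔫 h𝔪 g

/-- `ν` passes to the completion. [OURS · L1 W4.3] -/
theorem iotaCompletes_iotaOrd (p : ℕ) : IotaCompletes iotaOrd p :=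
  iotaCompletes_of_iotaDenseCompatible iotaDenseCompatible_iotaOrd p

/-- `σ` passes to the completion. [OURS · L1 W4.3] -/
theorem iotaCompletes_iotaSigma (p : ℕ) : IotaCompletes iotaSigma p :=
  iotaCompletes_of_iotaDenseCompatible iotaDenseCompatible_iotaSigma p

/-! ## The reduction -/

/-- The named triple of images is the image of the named triple. [folklore] -/
theorem vec₃_map {S S' : Type} (φ : S → S') (a b c : S) : (![φ a, φ b, φ c] : Fin 3 → S') = fun i => φ (![a, b, c] i) := by
  funext i
  fin_cases i <;> rfl

/-- **(K-red-2) — `KWildHomOf` FOLLOWS FROM ITS COMPLETE CASE.**  Given the complete-case drop `KWildHomCompleteOf Pos ι p`, the transfer of the position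
class to the completion (`PosCompletes`) and the two `ι`-rows (`IotaCompletes`, `IotaCobordantCompletes`), the conjecture-grade `KWildHomOf Pos ι p` holds:
pass to `Ŝ = AdicCompletion 𝔪 S` (regular, complete, same dimension and embedding dimension; `f·1 ≠ 0`, `∈ 𝔪̂²`; `ν` and the σ-maximising flag transfer) and
descend the (drop) conjunct by (K-red). [OURS · L1 W4.3 · (o60) (K-red-2)] -/
theorem kWildHomOf_of_complete {Pos : (R : Type) → [CommRing R] → [IsLocalRing R] → R → Prop} {ι : (R : Type) → [CommRing R] → R → Ordinal.{0}}
    {p : ℕ} (hK : KWildHomCompleteOf Pos ι p) (hPos : PosCompletes Pos p) (hιS : IotaCompletes ι p) (hιB : IotaCobordantCompletes ι p) :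
    KWildHomOf Pos ι p := by
  intro k₀ _ _ _ S _ _ _ _ f hdim hf0 hf2 hPosS ν hν x g₁ g₂ q r₁ r₂ hspan hrk hmax hprim
  haveI : IsNoetherianRing (AdicCompletion (maximalIdeal S) S) := isNoetherianRing_adicCompletion_maximalIdeal S
  haveI : IsRegularLocalRing (AdicCompletion (maximalIdeal S) S) := isRegularLocalRing_adicCompletion S
  have hm := map_maximalIdeal_adicCompletion S
  have hdense := adicCompletion_dense S
  have hdim' : ringKrullDim (AdicCompletion (maximalIdeal S) S) ≤ 3 := by rwa [ringKrullDim_adicCompletion]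
  have hf0' : algebraMap S (AdicCompletion (maximalIdeal S) S) f ≠ 0 := fun h => hf0 (by
    apply AdicCompletion.of_injective (maximalIdeal S) S
    rw [map_zero, ← h, AdicCompletion.algebraMap_apply, Algebra.algebraMap_self, RingHom.id_apply])
  have hf2' : algebraMap S (AdicCompletion (maximalIdeal S) S) f ∈ maximalIdeal (AdicCompletion (maximalIdeal S) S) ^ 2 := by
    rw [← hm, ← Ideal.map_pow]
    exact Ideal.mem_map_of_mem _ hf2
  have hν' : iotaOrd (AdicCompletion (maximalIdeal S) S) (algebraMap S _ f) = ν := by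
    rw [← hν]
    exact iotaDenseCompatible_iotaOrd S _ hm hdense f
  have hspan' : Ideal.span {algebraMap S (AdicCompletion (maximalIdeal S) S) x, algebraMap S _ g₂, algebraMap S _ g₁} =
      maximalIdeal (AdicCompletion (maximalIdeal S) S) := by
    rw [← hm, ← hspan, Ideal.map_span, Set.image_insert_eq, Set.image_insert_eq, Set.image_singleton]
  have hrk' : (maximalIdeal (AdicCompletion (maximalIdeal S) S)).spanFinrank = 3 := by
    rw [AdicCompletion.spanFinrank_maximalIdeal_eq, hrk]
  have hmax' := (IsSigmaMaximiser.algebraMap_iff_of_dense hm hdense).mpr hmax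
  have hW := hK k₀ (AdicCompletion (maximalIdeal S) S) (algebraMap S _ f) hdim' hf0' hf2' (hPos k₀ S f hdim hf0 hf2 hPosS) ν hν'
    (algebraMap S _ x) (algebraMap S _ g₁) (algebraMap S _ g₂) q r₁ r₂ hspan' hrk' hmax' hprim
  rw [vec₃_map] at hW
  obtain ⟨ψ, hψ, -, -, hψv, -, -⟩ := stub_extReesAlgebra_baseChange (weightedMonomialIdeal ![x, g₂, g₁] ![q, r₂, r₁])
    (weightedMonomialIdeal (fun i => algebraMap S (AdicCompletion (maximalIdeal S) S) (![x, g₂, g₁] i)) ![q, r₂, r₁])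
    (KRed.weightedMonomialIdeal_algebraMap_eq _ _)
  exact KRed.weightedDropHom_of_baseChange ![x, g₂, g₁] ![q, r₂, r₁] ψ hψ hψv hm hdense f (hιS k₀ S f)
    (fun 𝔫 _ _ hhom hT h𝔪 hv g => hιB k₀ S ![x, g₂, g₁] ![q, r₂, r₁] ψ hψ 𝔫 hhom hT h𝔪 hv g) hW

/-- **(K-red-2) for dense-compatible invariants**: with `IotaDenseCompatible ι` (e.g. `ν`, `σ`), only the complete-case drop and the position transfer remain.
[OURS · L1 W4.3 · (o60) (K-red-2)] -/
theorem kWildHomOf_of_complete_of_iotaDenseCompatible {Pos : (R : Type) → [CommRing R] → [IsLocalRing R] → R → Prop}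
    {ι : (R : Type) → [CommRing R] → R → Ordinal.{0}} {p : ℕ} (hK : KWildHomCompleteOf Pos ι p) (hPos : PosCompletes Pos p)
    (hι : IotaDenseCompatible ι) : KWildHomOf Pos ι p :=
  kWildHomOf_of_complete hK hPos (iotaCompletes_of_iotaDenseCompatible hι p) (iotaCobordantCompletes_of_iotaDenseCompatible hι p)

end Iota3

end Summit.ResolutionOfSingularities.ResolutionOfSingularities.Cruxes.HypersurfaceCentreConstruction.LocalEngine
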